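import Literature.NumberTheory.Transcendental.QuadraticRelationsLogarithmsSec5Assembly
import Literature.NumberTheory.Transcendental.QuadraticRelationsLogarithmsSec3Thm31
import HarnessLib

/-!
# Roy–Waldschmidt 1997: Théorème 0.2 from Théorème 2.1 and Théorème 4.1

D. Roy, M. Waldschmidt, *Approximation diophantienne et indépendance algébrique de logarithmes*,
Ann. Sci. ÉNS (4) 30 (1997) 753–796.

With Théorème 3.1 now proved (`RoyWaldschmidt1997.thm_3_1`, `…Sec3Thm31.lean`), the assembly
`royWaldschmidt_quadratic_thm_0_2_of_thms` (`…Sec5Assembly.lean`) gives Théorème 0.2 of the paper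
from the two remaining inputs: Théorème 2.1 (`h21`, the special case of Waldschmidt, *J. reine
angew. Math.* 493 (1997), Thm. 2.1 = [33] stated on pp. 761–762 — the paper's only external
theorem) and Théorème 4.1 (`h41`, p. 772, whose linear core is `thm_4_1_linear_core` of
`…Sec4Thm41Core.lean`).  No definitions, no named facts.

## References

* [RoyWaldschmidt1997ENS] D. Roy, M. Waldschmidt, Ann. Sci. ÉNS (4) 30 (1997) 753–796, Théorème 0.2
  p. 755, Théorème 2.1 pp. 761–762, Théorème 3.1 p. 763, Théorème 4.1 p. 772, §5 pp. 779–784.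
* [Waldschmidt1997Crelle] M. Waldschmidt, J. reine angew. Math. 493 (1997) 61–113, Théorème 2.1.
-/

noncomputable section

open Complex IntermediateField Module Submodule

namespace Literature.NumberTheory.Transcendental

namespace RoyWaldschmidt1997

open LiePresentation LinGroup

/-- **Théorème 0.2 of Roy–Waldschmidt from Théorème 2.1 (= [33, Thm. 2.1]) and Théorème 4.1**
(Théorème 3.1 being proved in `…Sec3Thm31.lean`).
[cite: RoyWaldschmidt1997ENS, Théorème 0.2 p. 755; Théorème 2.1 pp. 761–762; Théorème 4.1 p. 772] -/
theorem royWaldschmidt_quadratic_thm_0_2_of_thm_2_1_of_thm_4_1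
    (h21 : ∀ (d₀ d₁ ℓ₀ : ℕ) (N : Type) [Fintype N] (w : Fin ℓ₀ → (Fin d₀ → ℂ) × (Fin d₁ → ℂ))
      (η : N → (Fin d₀ → ℂ) × (Fin d₁ → ℂ))
      (Kt : IntermediateField ℚ ℂ) [FiniteDimensional ℚ Kt]
      (wt : Fin ℓ₀ → (Fin d₀ → ℂ) × (Fin d₁ → ℂ)) (ηt : N → (Fin d₀ → ℂ) × (Fin d₁ → ℂ))
      (A : Fin d₁ → ℝ) (B₁ B₂ E U V : ℝ) (S₀ T₀ T₁ : ℕ),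
      (∀ j, (∀ i, (wt j).1 i ∈ Kt) ∧ ∀ i, (wt j).2 i ∈ Kt) →
      (∀ j, (∀ i, (ηt j).1 i ∈ Kt) ∧ ∀ i, cexp ((ηt j).2 i) ∈ Kt) →
      (∃ j, LinGroup.exp (ηt j) = 1) →
      (∃ j, (η j).2 ≠ 0) →
      (∀ i, Real.exp 1 ≤ A i) → Real.exp 1 ≤ B₁ → Real.exp 1 ≤ B₂ → Real.exp 1 ≤ E → 0 < U → 0 < V →
      0 < S₀ → 0 < T₀ → 0 < T₁ → 2 * ((d₀ : ℝ) + d₁) ≤ B₁ → ((d₀ : ℝ) + d₁) ≤ B₂ →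
      (∀ i : Fin d₀, weilHeight₁ Kt (fun j : N => (ηt j).1 i) ≤ Real.log B₁) →
      (∀ j, weilHeight₁ Kt (Sum.elim (wt j).1 (wt j).2 : Fin d₀ ⊕ Fin d₁ → ℂ) ≤ Real.log B₂) →
      (∀ (i : Fin d₁) (j : N), weilHeight₁ Kt (fun _ : Unit => cexp ((ηt j).2 i)) ≤ Real.log (A i) ∧
        2 / (Module.finrank ℚ Kt : ℝ) ≤ Real.log (A i) ∧
        E / (Module.finrank ℚ Kt : ℝ) * ‖(ηt j).2 i‖ ≤ Real.log (A i)) →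
      (∀ j, ‖w j - wt j‖ ≤ Real.exp (-V)) → (∀ j, ‖η j - ηt j‖ ≤ Real.exp (-V)) →
      (Module.finrank ℚ Kt : ℝ) * (T₀ * Real.log B₁) ≤ U →
      (Module.finrank ℚ Kt : ℝ) * (S₀ * Real.log B₂) ≤ U →
      (Module.finrank ℚ Kt : ℝ) * (T₁ * ∑ i, Real.log (A i)) ≤ U →
      (12 * ((d₀ : ℝ) + d₁) + 13) * U ≤ V →
      Real.log E ≤ (Module.finrank ℚ Kt : ℝ) * Real.log B₁ →
      Real.log E ≤ (Module.finrank ℚ Kt : ℝ) * Real.log B₂ →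
      ((d₀ : ℝ) + d₁) * S₀ + T₀ + d₁ * T₁ ≤ B₂ →
      ((Nat.choose (T₀ + d₀) d₀ : ℝ) * ((T₁ : ℝ) + 1) ^ d₁ ≤ 1 / 8 * Real.exp (U / (2 * Module.finrank ℚ Kt))) →
      (4 * (V / Real.log E) ^ (Module.finrank ℂ (Submodule.span ℂ (Set.range w ∪ Set.range η))) ≤
        (Nat.choose (T₀ + d₀) d₀ : ℝ) * ((T₁ : ℝ) + 1) ^ d₁) →
      ∃ H : LinGroup.ConnAlgSubgroup d₀ d₁,
        H.tangent ≠ ⊤ ∧ LiePresentation.IsKRational Kt H.addPart ∧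
        (∃ F : Set (MvPolynomial (Fin d₀ ⊕ Fin d₁) ℂ),
          (∀ P ∈ F, (∀ m, P.coeff m ∈ Kt) ∧ ∀ i : Fin d₁, P.degreeOf (Sum.inr i) ≤ T₁) ∧
          (∀ g ∈ H.toSubgroup, ∀ P ∈ F, LinGroup.evalAt P g = 0) ∧
          ∀ H' : LinGroup.ConnAlgSubgroup d₀ d₁, H.toSubgroup ≤ H'.toSubgroup →
            (∀ g ∈ H'.toSubgroup, ∀ P ∈ F, LinGroup.evalAt P g = 0) → H'.toSubgroup = H.toSubgroup) ∧
        S₀ ^ (Module.finrank Kt ↥(Submodule.span Kt (Set.range wt)) -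
            Module.finrank Kt ↥(Submodule.span Kt (Set.range wt) ⊓ (H.tangent.restrictScalars Kt))) *
          Set.ncard ((QuotientGroup.mk : LinGroup d₀ d₁ → LinGroup d₀ d₁ ⧸ H.toSubgroup) ''
            Set.range (fun j => LinGroup.exp (ηt j))) *
          T₀ ^ H.addDim * T₁ ^ H.torusDim ≤
        (d₀ + d₁).factorial / d₀.factorial * T₀ ^ d₀ * T₁ ^ d₁)
    (h41 : ∀ (K : IntermediateField ℚ ℂ), K.FG → Algebra.trdeg ℚ K = 1 →
      ∀ (d₀ d₁ : ℕ) (p : Place K) (τ : p.ring →+* ℂ), p.IsReduction τ →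
      ∀ (Kt : IntermediateField ℚ ℂ) [FiniteDimensional ℚ Kt], (∀ x, τ x ∈ Kt) → Module.finrank ℚ Kt = p.deg →
      ∀ (ℓ₀ : ℕ) (N : Type) [Fintype N] (T₁ : ℕ) (w : Fin ℓ₀ → (Fin d₀ → ℂ) × (Fin d₁ → ℂ))
      (hw : ∀ j, (∀ i, (w j).1 i ∈ K) ∧ ∀ i, (w j).2 i ∈ K), LinearIndependent K w →
      ∀ (γ : N → LinGroup d₀ d₁)
      (hγ : ∀ j, (∀ i, Multiplicative.toAdd (γ j).1 i ∈ K) ∧ ∀ i, ((γ j).2 i : ℂ) ∈ K)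
      (H : LinGroup.ConnAlgSubgroup d₀ d₁), LiePresentation.IsKRational Kt H.addPart →
      (∃ F : Set (MvPolynomial (Fin d₀ ⊕ Fin d₁) ℂ),
      (∀ P ∈ F, (∀ m, P.coeff m ∈ Kt) ∧ ∀ i : Fin d₁, P.degreeOf (Sum.inr i) ≤ T₁) ∧
      (∀ g ∈ H.toSubgroup, ∀ P ∈ F, LinGroup.evalAt P g = 0) ∧
      ∀ H' : LinGroup.ConnAlgSubgroup d₀ d₁, H.toSubgroup ≤ H'.toSubgroup →
      (∀ g ∈ H'.toSubgroup, ∀ P ∈ F, LinGroup.evalAt P g = 0) → H'.toSubgroup = H.toSubgroup) →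
      (∀ j, (∀ i, (⟨(w j).1 i, (hw j).1 i⟩ : K) ∈ p.ring) ∧ ∀ i, (⟨(w j).2 i, (hw j).2 i⟩ : K) ∈ p.ring) →
      (∀ j, (∀ i, (⟨Multiplicative.toAdd (γ j).1 i, (hγ j).1 i⟩ : K) ∈ p.ring) ∧
      ∀ i, (⟨((γ j).2 i : ℂ), (hγ j).2 i⟩ : K) ∈ p.ring ∧ (⟨((γ j).2 i : ℂ)⁻¹, inv_mem ((hγ j).2 i)⟩ : K) ∈ p.ring) →
      ∀ (wt : Fin ℓ₀ → (Fin d₀ → ℂ) × (Fin d₁ → ℂ)) (γt : N → LinGroup d₀ d₁),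
      (∀ j, (∀ i (h : (⟨(w j).1 i, (hw j).1 i⟩ : K) ∈ p.ring), (wt j).1 i = τ ⟨_, h⟩) ∧
      ∀ i (h : (⟨(w j).2 i, (hw j).2 i⟩ : K) ∈ p.ring), (wt j).2 i = τ ⟨_, h⟩) →
      (∀ j, (∀ i (h : (⟨Multiplicative.toAdd (γ j).1 i, (hγ j).1 i⟩ : K) ∈ p.ring),
      Multiplicative.toAdd (γt j).1 i = τ ⟨_, h⟩) ∧
      ∀ i (h : (⟨((γ j).2 i : ℂ), (hγ j).2 i⟩ : K) ∈ p.ring), ((γt j).2 i : ℂ) = τ ⟨_, h⟩) →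
      ∀ (A' : Fin d₁ → ℝ) (B₁ B₂ : ℝ), (∀ i, Real.exp 1 ≤ A' i) → Real.exp 1 ≤ B₁ → Real.exp 1 ≤ B₂ →
      (∀ i : Fin d₀, (ffHeight₁ (fun j : N => (⟨Multiplicative.toAdd (γ j).1 i, (hγ j).1 i⟩ : K)) : ℝ) ≤ Real.log B₁) →
      (∀ j, (ffHeight₁ (Sum.elim (fun i => (⟨(w j).1 i, (hw j).1 i⟩ : K)) (fun i => (⟨(w j).2 i, (hw j).2 i⟩ : K))) : ℝ)
      ≤ Real.log B₂) →
      (∀ (i : Fin d₁) (j : N), (ffHeight₁ (fun _ : Unit => (⟨((γ j).2 i : ℂ), (hγ j).2 i⟩ : K)) : ℝ) ≤ Real.log (A' i)) →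
      max (2 * (d₁ : ℝ) * ((T₁ : ℝ) * ∑ i, Real.log (A' i))) (2 * (d₀ : ℝ) * Real.log B₁ + ℓ₀ * Real.log B₂) < p.deg →
      ∃ L : LinGroup.ConnAlgSubgroup d₀ d₁,
      LiePresentation.IsKRational K L.addPart ∧ L.addDim = H.addDim ∧ L.torusDim = H.torusDim ∧
      Set.ncard ((QuotientGroup.mk : LinGroup d₀ d₁ → LinGroup d₀ d₁ ⧸ L.toSubgroup) '' Set.range γ) ≤
      Set.ncard ((QuotientGroup.mk : LinGroup d₀ d₁ → LinGroup d₀ d₁ ⧸ H.toSubgroup) '' Set.range γt) ∧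
      Module.finrank K ↥(Submodule.span K (Set.range w)) -
      Module.finrank K ↥(Submodule.span K (Set.range w) ⊓ (L.tangent.restrictScalars K)) ≤
      Module.finrank Kt ↥(Submodule.span Kt (Set.range wt)) -
      Module.finrank Kt ↥(Submodule.span Kt (Set.range wt) ⊓ (H.tangent.restrictScalars Kt))) :
    royWaldschmidt_quadratic_thm_0_2 :=
  royWaldschmidt_quadratic_thm_0_2_of_thms h21 (fun _ hfg htr ι _ a => thm_3_1 hfg htr ι a) h41

end RoyWaldschmidt1997

end Literature.NumberTheory.Transcendental
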